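import Summits.AtomisticToContinuum.HydrodynamicLimit.Theorems.CollisionIsometryCLTCollisionalTransferLocalityBlockFields
import Summits.AtomisticToContinuum.HydrodynamicLimit.Theorems.CollisionIsometryCLTCollisionalTransferLocalityVirialGuard
import HarnessLib

/-!
# Pointwise comparison of the Euler-weighted collisional pressure with its equilibrium value
(stub [Rp] `abs_eulerW_pcoll_sub_le_pointwise`, line `hemisphere-affine-slaving`, crux
`CollisionalTransferLocality`, stmt-AtomisticToContinuum-9518)

Helper file (`--supports stmt-AtomisticToContinuum-9518`; registered stub
`abs_eulerW_pcoll_sub_le_pointwise`) of the line lead, equilibrium-rung infrastructure (Rhs side,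
deterministic core). On a dilute block (`ρ̄σ³ ≤ η₁`, inside the window `|Z(η) − 1| ≤ K η` of the
compressibility factor `Z = hsCompressibility`) the Euler-weighted collisional pressure
`eulerW · p_c(ρ̄, θ̄)`, `eulerW = div ψ + ∇χ·ū`, `p_c(ρ̄, θ̄) = pkin (Z(ρ̄σ³) − 1)`,
`pkin = ρ̄ θ̄ = (2/3)(Ē − |m̄|²/(2ρ̄))`, differs from its equilibrium value `div ψ · θ (Z(σ³) − 1)`
by at most

  `C₁ [(2/3) K η₁ |Ē − 3θ/2| + (K σ³/3) |m̄|² + θ |Z(ρ̄σ³) − Z(σ³)|] + 2 C₁ K σ³ |m̄| Ē`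

(`C₁` bounds `|div ψ|` and the components of `∇χ`). Algebra: with `z₁ = Z(ρ̄σ³) − 1`,
`p_c − θ(Z(σ³) − 1) = (pkin − θ) z₁ + θ (Z(ρ̄σ³) − Z(σ³))`,
`pkin − θ = (2/3)(Ē − 3θ/2) − |m̄|²/(3ρ̄)`, `|z₁| ≤ K ρ̄σ³ ≤ K η₁` (the `ρ̄⁻¹` of the momentum term
cancels against the `ρ̄` of `|z₁|`), `|∇χ·ū| ≤ 3 C₁ ρ̄⁻¹ |m̄|` and `0 ≤ pkin ≤ (2/3) Ē`
(`|m̄|² ≤ 2ρ̄Ē`); on an empty block (`ρ̄ = 0`) Lean's junk conventions give `p_c = 0` and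
`Z(0) = 1`, so the difference is `|div ψ| θ |Z(σ³) − 1| ≤ C₁ θ |Z(0·σ³) − Z(σ³)|`. Folklore algebra;
nothing is cited.
-/

namespace Summit.AtomisticToContinuum.HydrodynamicLimit.Theorems.HemisphereAffineSlaving

open scoped BigOperators Topology Classical ENNReal InnerProductSpace
open Filter Set Function MeasureTheory

noncomputable section

open Literature.MathematicalPhysics.KineticTheory (T3 V3 hsCompressibility hsPressure)

/-- Scalar core of [Rp] on a block with `ρ > 0`: with `|D| ≤ C₁`, `|S| ≤ 3 C₁ ρ⁻¹ |m|`,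
`p = (2/3) E − |m|²/(3ρ) ∈ [0, (2/3) E]`, `|Zη − 1| ≤ K ρ σ³ ≤ K η₁`,
`|(D + S) p (Zη − 1) − D θ (Zσ − 1)| ≤ C₁ [(2/3) K η₁ |E − 3θ/2| + (K σ³/3) |m|² + θ |Zη − Zσ|]
 + 2 C₁ K σ³ |m| E`. [folklore] -/
theorem abs_rp_core_le {θ σ3 K η₁ C₁ ρ E nm D S p Zη Zσ : ℝ} (hθ : 0 ≤ θ) (hσ3 : 0 ≤ σ3)
    (hK : 0 ≤ K) (hC₁ : 0 ≤ C₁) (hρ : 0 < ρ) (hnm : 0 ≤ nm) (hD : |D| ≤ C₁)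
    (hS : |S| ≤ 3 * C₁ * (ρ⁻¹ * nm)) (hp : p = 2 / 3 * E - nm ^ 2 / (3 * ρ)) (hp0 : 0 ≤ p)
    (hpE : p ≤ 2 / 3 * E) (hz : |Zη - 1| ≤ K * (ρ * σ3)) (hη : K * (ρ * σ3) ≤ K * η₁) :
    |(D + S) * (p * (Zη - 1)) - D * (θ * (Zσ - 1))| ≤
      C₁ * (2 / 3 * K * η₁ * |E - 3 / 2 * θ| + K * σ3 / 3 * nm ^ 2 + θ * |Zη - Zσ|) +
        2 * C₁ * K * σ3 * (nm * E) := by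
  have hsplit : (D + S) * (p * (Zη - 1)) - D * (θ * (Zσ - 1)) =
      D * (2 / 3 * (E - 3 / 2 * θ) * (Zη - 1)) + -(D * (nm ^ 2 / (3 * ρ) * (Zη - 1))) +
        D * (θ * (Zη - Zσ)) + S * (p * (Zη - 1)) := by
    rw [hp]; ring
  have h1 : |D| * |Zη - 1| ≤ C₁ * (K * η₁) := mul_le_mul hD (hz.trans hη) (abs_nonneg _) hC₁
  have h2 : |D| * |Zη - 1| ≤ C₁ * (K * (ρ * σ3)) := mul_le_mul hD hz (abs_nonneg _) hC₁
  have h4 : |S| * |Zη - 1| ≤ 3 * C₁ * (ρ⁻¹ * nm) * (K * (ρ * σ3)) :=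
    mul_le_mul hS hz (abs_nonneg _) (by positivity)
  have T1 : |D * (2 / 3 * (E - 3 / 2 * θ) * (Zη - 1))| ≤ C₁ * (2 / 3 * K * η₁ * |E - 3 / 2 * θ|) := by
    rw [abs_mul, abs_mul, abs_mul, abs_of_nonneg (by norm_num : (0 : ℝ) ≤ 2 / 3)]
    calc |D| * (2 / 3 * |E - 3 / 2 * θ| * |Zη - 1|)
        = 2 / 3 * |E - 3 / 2 * θ| * (|D| * |Zη - 1|) := by ring
      _ ≤ 2 / 3 * |E - 3 / 2 * θ| * (C₁ * (K * η₁)) := mul_le_mul_of_nonneg_left h1 (by positivity)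
      _ = C₁ * (2 / 3 * K * η₁ * |E - 3 / 2 * θ|) := by ring
  have T2 : |-(D * (nm ^ 2 / (3 * ρ) * (Zη - 1)))| ≤ C₁ * (K * σ3 / 3 * nm ^ 2) := by
    rw [abs_neg, abs_mul, abs_mul, abs_of_nonneg (by positivity : (0 : ℝ) ≤ nm ^ 2 / (3 * ρ))]
    calc |D| * (nm ^ 2 / (3 * ρ) * |Zη - 1|) = nm ^ 2 / (3 * ρ) * (|D| * |Zη - 1|) := by ring
      _ ≤ nm ^ 2 / (3 * ρ) * (C₁ * (K * (ρ * σ3))) := mul_le_mul_of_nonneg_left h2 (by positivity)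
      _ = C₁ * (K * σ3 / 3 * nm ^ 2) := by field_simp
  have T3 : |D * (θ * (Zη - Zσ))| ≤ C₁ * (θ * |Zη - Zσ|) := by
    rw [abs_mul, abs_mul, abs_of_nonneg hθ]
    exact mul_le_mul_of_nonneg_right hD (by positivity)
  have T4 : |S * (p * (Zη - 1))| ≤ 2 * C₁ * K * σ3 * (nm * E) := by
    rw [abs_mul, abs_mul, abs_of_nonneg hp0]
    calc |S| * (p * |Zη - 1|) = p * (|S| * |Zη - 1|) := by ring
      _ ≤ p * (3 * C₁ * (ρ⁻¹ * nm) * (K * (ρ * σ3))) := mul_le_mul_of_nonneg_left h4 hp0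
      _ = p * (3 * C₁ * K * σ3 * nm) := by field_simp
      _ ≤ 2 / 3 * E * (3 * C₁ * K * σ3 * nm) := mul_le_mul_of_nonneg_right hpE (by positivity)
      _ = 2 * C₁ * K * σ3 * (nm * E) := by ring
  rw [hsplit]
  refine ((abs_add_le _ _).trans (add_le_add ((abs_add_le _ _).trans
    (add_le_add (abs_add_le _ _) le_rfl)) le_rfl)).trans ?_
  linarith [T1, T2, T3, T4]

/-- **[Rp] Registered stub `abs_eulerW_pcoll_sub_le_pointwise`** of crux
stmt-AtomisticToContinuum-9518 (line hemisphere-affine-slaving, equilibrium rung, Rhs side):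
pointwise on a dilute block, the Euler-weighted collisional pressure `eulerW · p_c(ρ̄, θ̄)` differs
from `div ψ · θ (Z(σ³) − 1)` by at most
`C₁ [(2/3) K η₁ |Ē − 3θ/2| + (K σ³/3) |m̄|² + θ |Z(ρ̄σ³) − Z(σ³)|] + 2 C₁ K σ³ |m̄| Ē`.
On `ρ̄ > 0`: `p_c = pkin (Z(ρ̄σ³) − 1)`, `pkin = (2/3) Ē − |m̄|²/(3ρ̄) ∈ [0, (2/3)Ē]`
(`|m̄|² ≤ 2ρ̄Ē`), `|Z(ρ̄σ³) − 1| ≤ K ρ̄ σ³`, `|∇χ·ū| ≤ 3 C₁ ρ̄⁻¹ |m̄|`, and the scalar core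
`abs_rp_core_le`; on `ρ̄ = 0` both `p_c` and `Z(0) − 1` vanish. [folklore] -/
theorem abs_eulerW_pcoll_sub_le_pointwise : ∀ (θ σ K ηZ η₁ C₁ : ℝ), 0 < θ → 0 < σ → 0 ≤ K → 0 < η₁ → η₁ ≤ ηZ → σ ^ 3 ≤ ηZ → 0 ≤ C₁ → (∀ η : ℝ, 0 ≤ η → η ≤ ηZ → |Literature.MathematicalPhysics.KineticTheory.hsCompressibility η - 1| ≤ K * η) → ∀ (φ : ℕ → T3 → ℝ) (N : ℕ), (∀ y, 0 ≤ φ N y) → ∀ (ψ : ℝ → T3 → V3) (χ : ℝ → T3 → ℝ) (s : ℝ), (∀ y, |divPsi ψ s y| ≤ C₁) → (∀ y a, |gradChi χ s y a| ≤ C₁) → ∀ (w : Cfg N) (x : T3), rhoB φ N w x * σ ^ 3 ≤ η₁ → |eulerW ψ χ φ N s w x * pcoll σ (rhoB φ N w x) (thetaB φ N w x) - divPsi ψ s x * (θ * (Literature.MathematicalPhysics.KineticTheory.hsCompressibility (σ ^ 3) - 1))| ≤ C₁ * (2 / 3 * K * η₁ * |EB φ N w x - 3 / 2 * θ| + K *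 σ ^ 3 / 3 * ‖mB φ N w x‖ ^ 2 + θ * |Literature.MathematicalPhysics.KineticTheory.hsCompressibility (rhoB φ N w x * σ ^ 3) - Literature.MathematicalPhysics.KineticTheory.hsCompressibility (σ ^ 3)|) + 2 * C₁ * K * σ ^ 3 * (‖mB φ N w x‖ * EB φ N w x) := by
  intro θ σ K ηZ η₁ C₁ hθ hσ hK _hη₁ hη₁Z _hσZ hC₁ hZ φ N hφ0 ψ χ s hD hG w x hdil
  have hρ0 : 0 ≤ rhoB φ N w x := rhoB_nonneg hφ0
  have hE0 : 0 ≤ EB φ N w x := EB_nonneg hφ0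
  have hσ3 : 0 < σ ^ 3 := pow_pos hσ 3
  rcases hρ0.eq_or_lt with hρz | hρpos
  · -- empty block: `p_c = 0`, `Z(0) = 1`
    have hpc0 : pcoll σ 0 (thetaB φ N w x) = 0 := by simp [pcoll, hsPressure]
    have hZ0 : hsCompressibility (0 * σ ^ 3) = 1 := by simp [hsCompressibility]
    rw [← hρz, hpc0, mul_zero, zero_sub, abs_neg, hZ0]
    have e1 : |divPsi ψ s x * (θ * (hsCompressibility (σ ^ 3) - 1))| =
        |divPsi ψ s x| * (θ * |1 - hsCompressibility (σ ^ 3)|) := by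
      rw [abs_mul, abs_mul, abs_of_nonneg hθ.le, abs_sub_comm]
    have e2 : |divPsi ψ s x| * (θ * |1 - hsCompressibility (σ ^ 3)|) ≤
        C₁ * (θ * |1 - hsCompressibility (σ ^ 3)|) :=
      mul_le_mul_of_nonneg_right (hD x) (by positivity)
    have e3 : 0 ≤ C₁ * (2 / 3 * K * η₁ * |EB φ N w x - 3 / 2 * θ|) := by positivity
    have e4 : 0 ≤ C₁ * (K * σ ^ 3 / 3 * ‖mB φ N w x‖ ^ 2) := by positivity
    have e5 : 0 ≤ 2 * C₁ * K * σ ^ 3 * (‖mB φ N w x‖ * EB φ N w x) := by positivity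
    rw [e1]
    linarith
  · -- occupied block
    have hu : ∀ j, uB φ N w x j = (rhoB φ N w x)⁻¹ * mB φ N w x j := fun j => by simp [uB]
    have hS : |∑ j, gradChi χ s x j * uB φ N w x j| ≤
        3 * C₁ * ((rhoB φ N w x)⁻¹ * ‖mB φ N w x‖) := by
      calc |∑ j, gradChi χ s x j * uB φ N w x j|
          ≤ ∑ j, |gradChi χ s x j * uB φ N w x j| := Finset.abs_sum_le_sum_abs _ _
        _ ≤ ∑ _j : Fin 3, C₁ * ((rhoB φ N w x)⁻¹ * ‖mB φ N w x‖) :=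
            Finset.sum_le_sum fun j _ => by
              rw [abs_mul, hu j, abs_mul, abs_of_nonneg (inv_nonneg.2 hρ0)]
              refine mul_le_mul (hG x j) (mul_le_mul_of_nonneg_left ?_ (inv_nonneg.2 hρ0))
                (by positivity) hC₁
              rw [← Real.norm_eq_abs]
              exact PiLp.norm_apply_le _ j
        _ = 3 * C₁ * ((rhoB φ N w x)⁻¹ * ‖mB φ N w x‖) := by
            rw [Finset.sum_const, Finset.card_univ, Fintype.card_fin, nsmul_eq_mul]
            ring
    have hpc : pcoll σ (rhoB φ N w x) (thetaB φ N w x) =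
        pkin φ N w x * (hsCompressibility (rhoB φ N w x * σ ^ 3) - 1) := by
      simp only [pcoll, hsPressure, pkin]
      ring
    have hp : pkin φ N w x = 2 / 3 * EB φ N w x - ‖mB φ N w x‖ ^ 2 / (3 * rhoB φ N w x) := by
      simp only [pkin, thetaB]
      field_simp
    have hm2 := norm_mB_sq_le (w := w) (x := x) hφ0
    have hfrac : ‖mB φ N w x‖ ^ 2 / (3 * rhoB φ N w x) ≤ 2 / 3 * EB φ N w x := by
      rw [div_le_iff₀ (by positivity)]
      nlinarith
    have hfrac0 : 0 ≤ ‖mB φ N w x‖ ^ 2 / (3 * rhoB φ N w x) := by positivity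
    have hp0 : 0 ≤ pkin φ N w x := by rw [hp]; linarith
    have hpE : pkin φ N w x ≤ 2 / 3 * EB φ N w x := by rw [hp]; linarith
    have hz : |hsCompressibility (rhoB φ N w x * σ ^ 3) - 1| ≤ K * (rhoB φ N w x * σ ^ 3) :=
      hZ _ (by positivity) (hdil.trans hη₁Z)
    have hη : K * (rhoB φ N w x * σ ^ 3) ≤ K * η₁ := mul_le_mul_of_nonneg_left hdil hK
    rw [eulerW, hpc]
    exact abs_rp_core_le hθ.le hσ3.le hK hC₁ hρpos (norm_nonneg _) (hD x) hS hp hp0 hpE hz hη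

end

end Summit.AtomisticToContinuum.HydrodynamicLimit.Theorems.HemisphereAffineSlaving
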